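import Summits.QuantumFields.BalabanUV.Beta.CompositeVertexKernelRec
import Summits.QuantumFields.BalabanUV.Beta.GAN24.ContactLambdaCommutator

/-!
# `BalabanUV.Beta.CompositeVertexWardRooted` — row D1 ∕ (C1), PART 105a: THE COMPOSITE FIRST-ORDER WARD LAW BY INDUCTION ON THE DEPTH
# (generic bricks: the top-peeled composite vertex kernel's background divergence IS the composite linear kernel times the leg jump at the COMPOSED ROOT)

HONEST DEPENDENCY (page 1, mandatory): continuum YM on T⁴ ⇐ BetaPertH ∧ nine spine estimates (0/9 proved); BetaPertH ⇐ (D1) ∧ (D4) ∧ CAP+tail;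
G-an2-4 gates asym, D1 and NE2/3/4.  HONEST FRAMING (cell contract, verbatim): «discharging `BetaPertH` makes Bałaban's UV stability UNCONDITIONAL —
a real constructive-QFT result; it is NOT the continuum limit and NOT the Clay problem.»  ABSOLUTE RULE (cell charter, verbatim): «No internally-minted
statement may enter as a cited fact. Every hypothesis is either kernel-proved in this package or a verbatim quotation of a PUBLISHED theorem with page
reference. The manuscript(s) under audit are NOT citable for their own disputed steps — they are the thing under adjudication; programme-internal
(2001/route/tribunal) claims are never citable.»

WHY (row-D1 owner an2 gen 86, FINDING AN2-86-1 ∕ PART 104 `CompositeStencilWardReduction`).  PART 104 reduced the `hW𝒯 j` END's stencil letter (S)_j at `bhKcomp` to ONE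
border law of the composite V-table against the ROOTED-PLAIN composite rows.  This file proves the KERNEL-LEVEL Ward law of an2's top-peeled composite vertex kernel
`CompositeVertexKernelRec.compVHKer ℓ 𝓋 L m` for ANY brick pair `(ℓ, 𝓋)` obeying, at every level `k`, (i) the window pure-gauge law of the linear brick
(`hℓW`: the brick maps the fine pure gauge `dG` to the coarse jump of `G` between the ROOT `L•y + ρ k` and its `μ`-translate) and (ii) the window background-divergence
law of the vertex brick (`h𝓋W`: contracted with a pure gauge in its background slot the vertex brick is the linear brick times the jump of `G` between the root and the
fluctuation leg's site) — an1's (K-V2)ρ `AveragingWardRootedStencils.vhKerAt_div_right` and `linAvgAt_grad` are exactly these for the rooted single-comb-order bricks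
(instantiated in PART 105b).  By induction on the depth (`compLinKer_succ`, `compVHKer_succ`): the composite linear kernel maps fine pure gauges to coarse pure gauges read at
the COMPOSED ROOT `R m` (`R 0 = 0`, `R (m+1) = R m + L^m • ρ m`; `compLinKer_div`), and **the composite vertex kernel's background divergence is the composite linear kernel
times the leg jump `[L^m•y + R m = z] − [f.2 = z]`** (`compVHKer_div_right`) — the cross terms of the chain rule cancel level by level.

WHAT: [folklore] finite-sum induction BY NAME over an2's `compLinKer ∕ compVHKer`; no `def`, no `def … : Prop`, nothing cited, 0 sorry.  Nothing of Bałaban's asserted, valued or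
discharged; 0 estimates; 0∕4 row-D1 binders; (S)(W) NOT claimed; NOT (C1), NOT D1, NEVER «G-an2-4 closed», NOT BetaPertH, NOT continuum, NOT Clay.
Row D1 ∕ (C1) OWNER «beta-an2», gen 86, 2026-08-30.  No existing file touched.
-/

noncomputable section

open Finset
open scoped BigOperators
open Literature.MathematicalPhysics.QuantumFieldTheory.Balaban1983to89
open Literature.MathematicalPhysics.QuantumFieldTheory.Balaban1983to89.Beta
open AffineAveraging (Site box toSite unitVec dz)
open AveragingHessianKernels (Bond Near)
open AveragingHessianKernelsRooted (linKerAt vhKerAt linCountAt linKerAt_eq_zero vhKerAt_eq_zero_right)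
open AveragingContoursRooted (linAvgAt linAvgAt_grad)
open Summit.QuantumFields.BalabanUV.Beta.CompositeVertexKernelRec
open Summit.QuantumFields.BalabanUV.Beta.LinearGaugeVH (nearBox mem_nearBox)
open Summit.QuantumFields.BalabanUV.Beta.GAN24.ContactLambdaCommutator (linAvgAt_eq_sum_linCountAt)
open Summit.QuantumFields.BalabanUV.Beta.AveragingWardRootedStencils (vhKerAt_div_right)

namespace Summit.QuantumFields.BalabanUV.Beta.CompositeVertexWardRooted

variable {d : ℕ}

section Generic

variable {ℓ : ℕ → Fin (d + 1) → Site (d + 1) → Bond (d + 1) → ℝ}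
  {𝓋 : ℕ → Fin (d + 1) → Site (d + 1) → Bond (d + 1) → Bond (d + 1) → ℝ} {L : ℕ}
  {ρ : ℕ → Site (d + 1)} {R : ℕ → Site (d + 1)}
  (hR0 : R 0 = 0) (hRs : ∀ m : ℕ, R (m + 1) = R m + ((L ^ m : ℕ) : ℤ) • ρ m)
  (hℓW : ∀ (k : ℕ) (μ : Fin (d + 1)) (y : Site (d + 1)) (G : Site (d + 1) → ℝ),
    ∑ κ : Fin (d + 1), ∑ e ∈ offs L, ℓ k μ y (κ, (L : ℤ) • y + e) * (G ((L : ℤ) • y + e + unitVec κ) - G ((L : ℤ) • y + e)) =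
      G ((L : ℤ) • y + ρ k + (L : ℤ) • unitVec μ) - G ((L : ℤ) • y + ρ k))
  (h𝓋W : ∀ (k : ℕ) (μ : Fin (d + 1)) (y : Site (d + 1)) (f : Bond (d + 1)) (G : Site (d + 1) → ℝ),
    ∑ κ : Fin (d + 1), ∑ e ∈ offs L, 𝓋 k μ y f (κ, (L : ℤ) • y + e) * (G ((L : ℤ) • y + e + unitVec κ) - G ((L : ℤ) • y + e)) =
      (G ((L : ℤ) • y + ρ k) - G f.2) * ℓ k μ y f)

/-- [folklore] The leg jump of the identity kernel: `Σ_κ ([g = (κ, w − e_κ)] − [g = (κ, w)]) = [g.2 + e_{g.1} = w] − [g.2 = w]`. -/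
theorem sum_indicator_div (g : Bond (d + 1)) (w : Site (d + 1)) :
    ∑ κ : Fin (d + 1), ((if g = (κ, w - unitVec κ) then (1 : ℝ) else 0) - (if g = (κ, w) then (1 : ℝ) else 0)) =
      (if g.2 + unitVec g.1 = w then (1 : ℝ) else 0) - (if g.2 = w then (1 : ℝ) else 0) := by
  rw [Finset.sum_eq_single g.1]
  · have e1 : (g = (g.1, w - unitVec g.1)) ↔ g.2 + unitVec g.1 = w := by
      constructor
      · intro h; have h2 := congrArg Prod.snd h; simp only at h2; rw [h2, sub_add_cancel]
      · intro h; exact Prod.ext rfl (by simp only; rw [← h, add_sub_cancel_right])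
    have e2 : (g = (g.1, w)) ↔ g.2 = w :=
      ⟨fun h => by have h2 := congrArg Prod.snd h; exact h2, fun h => Prod.ext rfl h⟩
    rw [if_congr e1 rfl rfl, if_congr e2 rfl rfl]
  · intro κ _ hκ
    rw [if_neg (fun h => hκ (congrArg Prod.fst h).symm), if_neg (fun h => hκ (congrArg Prod.fst h).symm), sub_zero]
  · intro h; exact absurd (Finset.mem_univ _) h

include hR0 hRs hℓW in
/-- [folklore] **THE COMPOSITE LINEAR KERNEL MAPS FINE PURE GAUGES TO COARSE PURE GAUGES READ AT THE COMPOSED ROOT**: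
`Σ_κ (compLinKer m (κ, w − e_κ) g − compLinKer m (κ, w) g) = [L^m•(g.2 + e_{g.1}) + R m = w] − [L^m•g.2 + R m = w]`. -/
theorem compLinKer_div : ∀ (m : ℕ) (g : Bond (d + 1)) (w : Site (d + 1)),
    ∑ κ : Fin (d + 1), (compLinKer ℓ L m (κ, w - unitVec κ) g - compLinKer ℓ L m (κ, w) g) =
      (if ((L ^ m : ℕ) : ℤ) • (g.2 + unitVec g.1) + R m = w then (1 : ℝ) else 0) -
        (if ((L ^ m : ℕ) : ℤ) • g.2 + R m = w then (1 : ℝ) else 0)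
  | 0, g, w => by
    simp only [compLinKer_zero, pow_zero, Nat.cast_one, one_smul, hR0, add_zero]
    exact sum_indicator_div g w
  | m + 1, g, w => by
    -- the generator read through the depth-`m` composed root
    set G : Site (d + 1) → ℝ := fun x => if ((L ^ m : ℕ) : ℤ) • x + R m = w then (1 : ℝ) else 0 with hG
    calc ∑ κ' : Fin (d + 1), (compLinKer ℓ L (m + 1) (κ', w - unitVec κ') g - compLinKer ℓ L (m + 1) (κ', w) g)
        = ∑ κ' : Fin (d + 1), ∑ κ : Fin (d + 1), ∑ e ∈ offs L, ℓ m g.1 g.2 (κ, (L : ℤ) • g.2 + e) *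
            (compLinKer ℓ L m (κ', w - unitVec κ') (κ, (L : ℤ) • g.2 + e) - compLinKer ℓ L m (κ', w) (κ, (L : ℤ) • g.2 + e)) := by
          refine Finset.sum_congr rfl fun κ' _ => ?_
          rw [compLinKer_succ, compLinKer_succ, ← Finset.sum_sub_distrib]
          refine Finset.sum_congr rfl fun κ _ => ?_
          rw [← Finset.sum_sub_distrib]
          refine Finset.sum_congr rfl fun e _ => ?_
          ring
      _ = ∑ κ : Fin (d + 1), ∑ e ∈ offs L, ℓ m g.1 g.2 (κ, (L : ℤ) • g.2 + e) *
            ∑ κ' : Fin (d + 1), (compLinKer ℓ L m (κ', w - unitVec κ') (κ, (L : ℤ) • g.2 + e) - compLinKer ℓ L m (κ', w) (κ, (L : ℤ) • g.2 + e)) := by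
          rw [Finset.sum_comm]
          refine Finset.sum_congr rfl fun κ _ => ?_
          rw [Finset.sum_comm]
          refine Finset.sum_congr rfl fun e _ => ?_
          rw [Finset.mul_sum]
      _ = ∑ κ : Fin (d + 1), ∑ e ∈ offs L, ℓ m g.1 g.2 (κ, (L : ℤ) • g.2 + e) * (G ((L : ℤ) • g.2 + e + unitVec κ) - G ((L : ℤ) • g.2 + e)) := by
          refine Finset.sum_congr rfl fun κ _ => Finset.sum_congr rfl fun e _ => ?_
          rw [compLinKer_div m (κ, (L : ℤ) • g.2 + e) w]
      _ = G ((L : ℤ) • g.2 + ρ m + (L : ℤ) • unitVec g.1) - G ((L : ℤ) • g.2 + ρ m) := hℓW m g.1 g.2 G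
      _ = (if ((L ^ (m + 1) : ℕ) : ℤ) • (g.2 + unitVec g.1) + R (m + 1) = w then (1 : ℝ) else 0) -
            (if ((L ^ (m + 1) : ℕ) : ℤ) • g.2 + R (m + 1) = w then (1 : ℝ) else 0) := by
          have e1 : ((L ^ m : ℕ) : ℤ) • ((L : ℤ) • g.2 + ρ m + (L : ℤ) • unitVec g.1) + R m =
              ((L ^ (m + 1) : ℕ) : ℤ) • (g.2 + unitVec g.1) + R (m + 1) := by
            rw [hRs m]; push_cast; simp only [smul_add, smul_smul, pow_succ]; abel
          have e2 : ((L ^ m : ℕ) : ℤ) • ((L : ℤ) • g.2 + ρ m) + R m = ((L ^ (m + 1) : ℕ) : ℤ) • g.2 + R (m + 1) := by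
            rw [hRs m]; push_cast; simp only [smul_add, smul_smul, pow_succ]; abel
          simp only [hG, e1, e2]

include hR0 hRs hℓW h𝓋W in
/-- [folklore] **THE COMPOSITE FIRST-ORDER WARD LAW (kernel level, every depth)**: contracted with a fine pure gauge in its BACKGROUND slot, the top-peeled composite
vertex kernel is the composite linear kernel times the leg jump between the COMPOSED ROOT and the fluctuation leg's site:
`Σ_κ (compVHKer m μ y f (κ, z − e_κ) − compVHKer m μ y f (κ, z)) = ([L^m•y + R m = z] − [f.2 = z]) · compLinKer m f (μ, y)`
(induction on `m`: the chain rule `compVHKer_succ`; the level-`m` cross terms `Σ_b [b-root = z]·ℓ·compLinKer` of its two summands CANCEL). -/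
theorem compVHKer_div_right : ∀ (m : ℕ) (μ : Fin (d + 1)) (y : Site (d + 1)) (f : Bond (d + 1)) (z : Site (d + 1)),
    ∑ κ : Fin (d + 1), (compVHKer ℓ 𝓋 L m μ y f (κ, z - unitVec κ) - compVHKer ℓ 𝓋 L m μ y f (κ, z)) =
      ((if ((L ^ m : ℕ) : ℤ) • y + R m = z then (1 : ℝ) else 0) - (if f.2 = z then (1 : ℝ) else 0)) * compLinKer ℓ L m f (μ, y)
  | 0, μ, y, f, z => by
    simp only [compVHKer_zero, sub_self, Finset.sum_const_zero, compLinKer_zero, pow_zero, Nat.cast_one, one_smul, hR0, add_zero]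
    by_cases h : ((μ, y) : Bond (d + 1)) = f
    · rw [if_pos h, ← h, sub_self, zero_mul]
    · rw [if_neg h, mul_zero]
  | m + 1, μ, y, f, z => by
    set G : Site (d + 1) → ℝ := fun x => if ((L ^ m : ℕ) : ℤ) • x + R m = z then (1 : ℝ) else 0 with hG
    -- the first summand of the chain rule: the top vertex brick along two transported bonds
    have hA : ∑ κ' : Fin (d + 1),
        ((∑ κ : Fin (d + 1), ∑ e ∈ offs L, ∑ κ₂ : Fin (d + 1), ∑ e' ∈ offs L,
            𝓋 m μ y (κ, (L : ℤ) • y + e) (κ₂, (L : ℤ) • y + e') *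
              compLinKer ℓ L m f (κ, (L : ℤ) • y + e) * compLinKer ℓ L m (κ', z - unitVec κ') (κ₂, (L : ℤ) • y + e')) -
          (∑ κ : Fin (d + 1), ∑ e ∈ offs L, ∑ κ₂ : Fin (d + 1), ∑ e' ∈ offs L,
            𝓋 m μ y (κ, (L : ℤ) • y + e) (κ₂, (L : ℤ) • y + e') *
              compLinKer ℓ L m f (κ, (L : ℤ) • y + e) * compLinKer ℓ L m (κ', z) (κ₂, (L : ℤ) • y + e'))) =
        ∑ κ : Fin (d + 1), ∑ e ∈ offs L, compLinKer ℓ L m f (κ, (L : ℤ) • y + e) *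
          ((G ((L : ℤ) • y + ρ m) - G ((L : ℤ) • y + e)) * ℓ m μ y (κ, (L : ℤ) • y + e)) := by
      calc _ = ∑ κ' : Fin (d + 1), ∑ κ : Fin (d + 1), ∑ e ∈ offs L, ∑ κ₂ : Fin (d + 1), ∑ e' ∈ offs L,
            𝓋 m μ y (κ, (L : ℤ) • y + e) (κ₂, (L : ℤ) • y + e') * compLinKer ℓ L m f (κ, (L : ℤ) • y + e) *
              (compLinKer ℓ L m (κ', z - unitVec κ') (κ₂, (L : ℤ) • y + e') - compLinKer ℓ L m (κ', z) (κ₂, (L : ℤ) • y + e')) := by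
            refine Finset.sum_congr rfl fun κ' _ => ?_
            simp only [← Finset.sum_sub_distrib, ← mul_sub]
        _ = ∑ κ : Fin (d + 1), ∑ e ∈ offs L, ∑ κ₂ : Fin (d + 1), ∑ e' ∈ offs L, ∑ κ' : Fin (d + 1),
            𝓋 m μ y (κ, (L : ℤ) • y + e) (κ₂, (L : ℤ) • y + e') * compLinKer ℓ L m f (κ, (L : ℤ) • y + e) *
              (compLinKer ℓ L m (κ', z - unitVec κ') (κ₂, (L : ℤ) • y + e') - compLinKer ℓ L m (κ', z) (κ₂, (L : ℤ) • y + e')) := by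
            rw [Finset.sum_comm]
            refine Finset.sum_congr rfl fun κ _ => ?_
            rw [Finset.sum_comm]
            refine Finset.sum_congr rfl fun e _ => ?_
            rw [Finset.sum_comm]
            refine Finset.sum_congr rfl fun κ₂ _ => ?_
            rw [Finset.sum_comm]
        _ = ∑ κ : Fin (d + 1), ∑ e ∈ offs L, compLinKer ℓ L m f (κ, (L : ℤ) • y + e) *
            ∑ κ₂ : Fin (d + 1), ∑ e' ∈ offs L, 𝓋 m μ y (κ, (L : ℤ) • y + e) (κ₂, (L : ℤ) • y + e') *
              ∑ κ' : Fin (d + 1), (compLinKer ℓ L m (κ', z - unitVec κ') (κ₂, (L : ℤ) • y + e') - compLinKer ℓ L m (κ', z) (κ₂, (L : ℤ) • y + e')) := by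
            refine Finset.sum_congr rfl fun κ _ => Finset.sum_congr rfl fun e _ => ?_
            rw [Finset.mul_sum]
            refine Finset.sum_congr rfl fun κ₂ _ => ?_
            rw [Finset.mul_sum]
            refine Finset.sum_congr rfl fun e' _ => ?_
            rw [Finset.mul_sum, Finset.mul_sum]
            refine Finset.sum_congr rfl fun κ' _ => ?_
            ring
        _ = ∑ κ : Fin (d + 1), ∑ e ∈ offs L, compLinKer ℓ L m f (κ, (L : ℤ) • y + e) *
            ∑ κ₂ : Fin (d + 1), ∑ e' ∈ offs L, 𝓋 m μ y (κ, (L : ℤ) • y + e) (κ₂, (L : ℤ) • y + e') *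
              (G ((L : ℤ) • y + e' + unitVec κ₂) - G ((L : ℤ) • y + e')) := by
            refine Finset.sum_congr rfl fun κ _ => Finset.sum_congr rfl fun e _ => ?_
            congr 1
            refine Finset.sum_congr rfl fun κ₂ _ => Finset.sum_congr rfl fun e' _ => ?_
            rw [compLinKer_div hR0 hRs hℓW m (κ₂, (L : ℤ) • y + e') z]
        _ = _ := by
            refine Finset.sum_congr rfl fun κ _ => Finset.sum_congr rfl fun e _ => ?_
            rw [h𝓋W m μ y (κ, (L : ℤ) • y + e) G]
    -- the second summand: the top linear brick composed with the depth-`m` composite vertex (induction hypothesis)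
    have hB : ∑ κ' : Fin (d + 1),
        ((∑ κ : Fin (d + 1), ∑ e ∈ offs L, ℓ m μ y (κ, (L : ℤ) • y + e) * compVHKer ℓ 𝓋 L m κ ((L : ℤ) • y + e) f (κ', z - unitVec κ')) -
          (∑ κ : Fin (d + 1), ∑ e ∈ offs L, ℓ m μ y (κ, (L : ℤ) • y + e) * compVHKer ℓ 𝓋 L m κ ((L : ℤ) • y + e) f (κ', z))) =
        ∑ κ : Fin (d + 1), ∑ e ∈ offs L, ℓ m μ y (κ, (L : ℤ) • y + e) *
          ((G ((L : ℤ) • y + e) - (if f.2 = z then (1 : ℝ) else 0)) * compLinKer ℓ L m f (κ, (L : ℤ) • y + e)) := by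
      calc _ = ∑ κ' : Fin (d + 1), ∑ κ : Fin (d + 1), ∑ e ∈ offs L, ℓ m μ y (κ, (L : ℤ) • y + e) *
            (compVHKer ℓ 𝓋 L m κ ((L : ℤ) • y + e) f (κ', z - unitVec κ') - compVHKer ℓ 𝓋 L m κ ((L : ℤ) • y + e) f (κ', z)) := by
            refine Finset.sum_congr rfl fun κ' _ => ?_
            simp only [← Finset.sum_sub_distrib, ← mul_sub]
        _ = ∑ κ : Fin (d + 1), ∑ e ∈ offs L, ∑ κ' : Fin (d + 1), ℓ m μ y (κ, (L : ℤ) • y + e) *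
            (compVHKer ℓ 𝓋 L m κ ((L : ℤ) • y + e) f (κ', z - unitVec κ') - compVHKer ℓ 𝓋 L m κ ((L : ℤ) • y + e) f (κ', z)) := by
            rw [Finset.sum_comm]
            refine Finset.sum_congr rfl fun κ _ => ?_
            rw [Finset.sum_comm]
        _ = _ := by
            refine Finset.sum_congr rfl fun κ _ => Finset.sum_congr rfl fun e _ => ?_
            rw [← Finset.mul_sum, compVHKer_div_right m κ ((L : ℤ) • y + e) f z]
    -- assemble: the cross terms cancel
    have hroot : G ((L : ℤ) • y + ρ m) = if ((L ^ (m + 1) : ℕ) : ℤ) • y + R (m + 1) = z then (1 : ℝ) else 0 := by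
      have e2 : ((L ^ m : ℕ) : ℤ) • ((L : ℤ) • y + ρ m) + R m = ((L ^ (m + 1) : ℕ) : ℤ) • y + R (m + 1) := by
        rw [hRs m]; push_cast; simp only [smul_add, smul_smul, pow_succ]; abel
      simp only [hG, e2]
    calc ∑ κ' : Fin (d + 1), (compVHKer ℓ 𝓋 L (m + 1) μ y f (κ', z - unitVec κ') - compVHKer ℓ 𝓋 L (m + 1) μ y f (κ', z))
        = (∑ κ' : Fin (d + 1),
            ((∑ κ : Fin (d + 1), ∑ e ∈ offs L, ∑ κ₂ : Fin (d + 1), ∑ e' ∈ offs L,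
                𝓋 m μ y (κ, (L : ℤ) • y + e) (κ₂, (L : ℤ) • y + e') *
                  compLinKer ℓ L m f (κ, (L : ℤ) • y + e) * compLinKer ℓ L m (κ', z - unitVec κ') (κ₂, (L : ℤ) • y + e')) -
              (∑ κ : Fin (d + 1), ∑ e ∈ offs L, ∑ κ₂ : Fin (d + 1), ∑ e' ∈ offs L,
                𝓋 m μ y (κ, (L : ℤ) • y + e) (κ₂, (L : ℤ) • y + e') *
                  compLinKer ℓ L m f (κ, (L : ℤ) • y + e) * compLinKer ℓ L m (κ', z) (κ₂, (L : ℤ) • y + e')))) +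
          ∑ κ' : Fin (d + 1),
            ((∑ κ : Fin (d + 1), ∑ e ∈ offs L, ℓ m μ y (κ, (L : ℤ) • y + e) * compVHKer ℓ 𝓋 L m κ ((L : ℤ) • y + e) f (κ', z - unitVec κ')) -
              (∑ κ : Fin (d + 1), ∑ e ∈ offs L, ℓ m μ y (κ, (L : ℤ) • y + e) * compVHKer ℓ 𝓋 L m κ ((L : ℤ) • y + e) f (κ', z))) := by
          rw [← Finset.sum_add_distrib]
          refine Finset.sum_congr rfl fun κ' _ => ?_
          rw [compVHKer_succ, compVHKer_succ]
          ring
      _ = ∑ κ : Fin (d + 1), ∑ e ∈ offs L, compLinKer ℓ L m f (κ, (L : ℤ) • y + e) *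
            ((G ((L : ℤ) • y + ρ m) - G ((L : ℤ) • y + e)) * ℓ m μ y (κ, (L : ℤ) • y + e)) +
          ∑ κ : Fin (d + 1), ∑ e ∈ offs L, ℓ m μ y (κ, (L : ℤ) • y + e) *
            ((G ((L : ℤ) • y + e) - (if f.2 = z then (1 : ℝ) else 0)) * compLinKer ℓ L m f (κ, (L : ℤ) • y + e)) := by rw [hA, hB]
      _ = (G ((L : ℤ) • y + ρ m) - (if f.2 = z then (1 : ℝ) else 0)) *
            ∑ κ : Fin (d + 1), ∑ e ∈ offs L, ℓ m μ y (κ, (L : ℤ) • y + e) * compLinKer ℓ L m f (κ, (L : ℤ) • y + e) := by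
          rw [← Finset.sum_add_distrib, Finset.mul_sum]
          refine Finset.sum_congr rfl fun κ _ => ?_
          rw [← Finset.sum_add_distrib, Finset.mul_sum]
          refine Finset.sum_congr rfl fun e _ => ?_
          ring
      _ = _ := by rw [hroot, compLinKer_succ]

end Generic

/-! ## §2 The rooted single-comb-order bricks obey the two window laws -/

section Rooted

variable {L : ℕ} {r : Fin (d + 1) → ℕ}

/-- [folklore] A window sum in offset coordinates is the sum over the `nearBox`. -/
theorem sum_offs_eq_sum_nearBox (y : Site (d + 1)) (F : Site (d + 1) → ℝ) :
    ∑ e ∈ offs L, F ((L : ℤ) • y + e) = ∑ x ∈ nearBox L y, F x := by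
  classical
  have himg : (offs L).image (fun e => (L : ℤ) • y + e) = nearBox L y := by
    ext x
    rw [Finset.mem_image, mem_nearBox, near_iff_exists_offs]
    exact ⟨fun ⟨e, he, h⟩ => ⟨e, he, h.symm⟩, fun ⟨e, he, h⟩ => ⟨e, he, h.symm⟩⟩
  rw [← himg, Finset.sum_image fun e _ e' _ h => smul_add_right_injective L y h]

/-- [folklore] **THE WINDOW PURE-GAUGE LAW OF THE ROOTED LINEAR BRICK** (`hℓW` for `linKerAt (toSite r) L`, box root, `1 ≤ L`): the normalised rooted averaging kernel maps the fine
pure gauge `dG` to the jump of `G` between the ROOT `L•y + ρ` and its `L•e_μ`-translate (an1 `linAvgAt_grad`, the bond-count expansion `linAvgAt_eq_sum_linCountAt`, `#box = L^{d+1}`). -/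
theorem linKerAt_window_dz (hL : 1 ≤ L) (hr : r ∈ box (d + 1) L) (μ : Fin (d + 1)) (y : Site (d + 1)) (G : Site (d + 1) → ℝ) :
    ∑ κ : Fin (d + 1), ∑ e ∈ offs L, linKerAt (toSite r) L μ y (κ, (L : ℤ) • y + e) * (G ((L : ℤ) • y + e + unitVec κ) - G ((L : ℤ) • y + e)) =
      G ((L : ℤ) • y + toSite r + (L : ℤ) • unitVec μ) - G ((L : ℤ) • y + toSite r) := by
  have hL' : (L : ℝ) ^ (d + 1) ≠ 0 := pow_ne_zero _ (by exact_mod_cast (show L ≠ 0 by omega))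
  have hcard : ((box (d + 1) L).card : ℝ) = (L : ℝ) ^ (d + 1) := by
    rw [show (box (d + 1) L).card = L ^ (d + 1) by simp [AffineAveraging.box, Fintype.card_piFinset]]; push_cast; rfl
  calc ∑ κ : Fin (d + 1), ∑ e ∈ offs L, linKerAt (toSite r) L μ y (κ, (L : ℤ) • y + e) * (G ((L : ℤ) • y + e + unitVec κ) - G ((L : ℤ) • y + e))
      = ∑ x ∈ nearBox L y, ∑ κ : Fin (d + 1), (linCountAt (toSite r) L μ y (κ, x) : ℝ) * (((L : ℝ) ^ (d + 1))⁻¹ * dz G κ x) := by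
        rw [Finset.sum_comm, ← sum_offs_eq_sum_nearBox y (fun x => ∑ κ : Fin (d + 1), (linCountAt (toSite r) L μ y (κ, x) : ℝ) * (((L : ℝ) ^ (d + 1))⁻¹ * dz G κ x))]
        refine Finset.sum_congr rfl fun e _ => Finset.sum_congr rfl fun κ _ => ?_
        rw [linKerAt, dz, div_eq_mul_inv]
        ring
    _ = ((L : ℝ) ^ (d + 1))⁻¹ * linAvgAt (toSite r) (dz G) L μ y := by
        rw [linAvgAt_eq_sum_linCountAt hr (dz G) μ y, Finset.mul_sum]
        refine Finset.sum_congr rfl fun x _ => ?_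
        rw [Finset.mul_sum]
        refine Finset.sum_congr rfl fun κ _ => ?_
        ring
    _ = G ((L : ℤ) • y + toSite r + (L : ℤ) • unitVec μ) - G ((L : ℤ) • y + toSite r) := by
        have h : linAvgAt (toSite r) (dz G) L μ y =
            (box (d + 1) L).card • (G ((L : ℤ) • y + toSite r + (L : ℤ) • unitVec μ) - G ((L : ℤ) • y + toSite r)) :=
          linAvgAt_grad (toSite r) G L μ y
        rw [h, nsmul_eq_mul, hcard, inv_mul_cancel_left₀ hL']

/-- [folklore] **THE WINDOW BACKGROUND-DIVERGENCE LAW OF THE ROOTED VERTEX BRICK** (`h𝓋W` for `vhKerAt (toSite r) L`, box root, `1 ≤ L`), for ANY coarse weight `G`: contracted with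
the fine pure gauge `dG` in its background slot (over the window, where it lives: `vhKerAt_eq_zero_right`) the vertex brick is the linear brick times the jump of `G` between the
ROOT and the fluctuation leg's site — an1's pointwise (K-V2)ρ `vhKerAt_div_right` summed by parts. -/
theorem vhKerAt_window_dz (hL : 1 ≤ L) (hr : r ∈ box (d + 1) L) (μ : Fin (d + 1)) (y : Site (d + 1)) (f : Bond (d + 1)) (G : Site (d + 1) → ℝ) :
    ∑ κ : Fin (d + 1), ∑ e ∈ offs L, vhKerAt (toSite r) L μ y f (κ, (L : ℤ) • y + e) * (G ((L : ℤ) • y + e + unitVec κ) - G ((L : ℤ) • y + e)) =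
      (G ((L : ℤ) • y + toSite r) - G f.2) * linKerAt (toSite r) L μ y f := by
  classical
  -- support of the brick in its background slot
  have hsupp : ∀ (κ : Fin (d + 1)) (x : Site (d + 1)), x ∉ nearBox L y → vhKerAt (toSite r) L μ y f (κ, x) = 0 :=
    fun κ x hx => vhKerAt_eq_zero_right hr f (f' := (κ, x)) (fun h => hx (mem_nearBox.2 h))
  -- the shifted support: `x ↦ 𝓋 (κ, x − e_κ)` vanishes off `nearBox + e_κ`
  have hsupp' : ∀ (κ : Fin (d + 1)) (x : Site (d + 1)), x ∉ (nearBox L y).image (fun x' => x' + unitVec κ) →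
      vhKerAt (toSite r) L μ y f (κ, x - unitVec κ) = 0 := by
    intro κ x hx
    apply hsupp κ (x - unitVec κ)
    intro hmem
    exact hx (Finset.mem_image.2 ⟨x - unitVec κ, hmem, sub_add_cancel x (unitVec κ)⟩)
  -- summability (finite supports)
  have hs1 : ∀ κ : Fin (d + 1), Summable fun x : Site (d + 1) => vhKerAt (toSite r) L μ y f (κ, x - unitVec κ) * G x :=
    fun κ => summable_of_ne_finset_zero (s := (nearBox L y).image (fun x' => x' + unitVec κ)) fun x hx => by rw [hsupp' κ x hx, zero_mul]
  have hs2 : ∀ κ : Fin (d + 1), Summable fun x : Site (d + 1) => vhKerAt (toSite r) L μ y f (κ, x) * G x :=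
    fun κ => summable_of_ne_finset_zero (s := nearBox L y) fun x hx => by rw [hsupp κ x hx, zero_mul]
  have hs3 : ∀ κ : Fin (d + 1), Summable fun x : Site (d + 1) =>
      (vhKerAt (toSite r) L μ y f (κ, x - unitVec κ) - vhKerAt (toSite r) L μ y f (κ, x)) * G x :=
    fun κ => ((hs1 κ).sub (hs2 κ)).congr fun x => by ring
  -- (1) each window sum as a sum over `ℤ^{d+1}`, the translated one re-indexed
  have key : ∀ κ : Fin (d + 1), ∑ e ∈ offs L, vhKerAt (toSite r) L μ y f (κ, (L : ℤ) • y + e) * (G ((L : ℤ) • y + e + unitVec κ) - G ((L : ℤ) • y + e)) =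
      ∑' x : Site (d + 1), (vhKerAt (toSite r) L μ y f (κ, x - unitVec κ) - vhKerAt (toSite r) L μ y f (κ, x)) * G x := by
    intro κ
    have hA : ∑' x : Site (d + 1), vhKerAt (toSite r) L μ y f (κ, x - unitVec κ) * G x =
        ∑ e ∈ offs L, vhKerAt (toSite r) L μ y f (κ, (L : ℤ) • y + e) * G ((L : ℤ) • y + e + unitVec κ) := by
      rw [← (Equiv.addRight (unitVec κ)).tsum_eq (fun x : Site (d + 1) => vhKerAt (toSite r) L μ y f (κ, x - unitVec κ) * G x)]
      simp only [Equiv.coe_addRight, add_sub_cancel_right]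
      rw [tsum_eq_sum (s := nearBox L y) (fun x hx => by rw [hsupp κ x hx, zero_mul])]
      exact (sum_offs_eq_sum_nearBox y (fun x => vhKerAt (toSite r) L μ y f (κ, x) * G (x + unitVec κ))).symm
    have hB : ∑' x : Site (d + 1), vhKerAt (toSite r) L μ y f (κ, x) * G x =
        ∑ e ∈ offs L, vhKerAt (toSite r) L μ y f (κ, (L : ℤ) • y + e) * G ((L : ℤ) • y + e) := by
      rw [tsum_eq_sum (s := nearBox L y) (fun x hx => by rw [hsupp κ x hx, zero_mul])]
      exact (sum_offs_eq_sum_nearBox y (fun x => vhKerAt (toSite r) L μ y f (κ, x) * G x)).symm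
    calc ∑ e ∈ offs L, vhKerAt (toSite r) L μ y f (κ, (L : ℤ) • y + e) * (G ((L : ℤ) • y + e + unitVec κ) - G ((L : ℤ) • y + e))
        = ∑ e ∈ offs L, vhKerAt (toSite r) L μ y f (κ, (L : ℤ) • y + e) * G ((L : ℤ) • y + e + unitVec κ) -
            ∑ e ∈ offs L, vhKerAt (toSite r) L μ y f (κ, (L : ℤ) • y + e) * G ((L : ℤ) • y + e) := by
          simp only [mul_sub, Finset.sum_sub_distrib]
      _ = ∑' x : Site (d + 1), vhKerAt (toSite r) L μ y f (κ, x - unitVec κ) * G x - ∑' x : Site (d + 1), vhKerAt (toSite r) L μ y f (κ, x) * G x := by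
          rw [hA, hB]
      _ = ∑' x : Site (d + 1), (vhKerAt (toSite r) L μ y f (κ, x - unitVec κ) * G x - vhKerAt (toSite r) L μ y f (κ, x) * G x) :=
          ((hs1 κ).tsum_sub (hs2 κ)).symm
      _ = _ := tsum_congr fun x => by ring
  -- the two point masses of the jump
  have hsP : Summable fun x : Site (d + 1) => (if (L : ℤ) • y + toSite r = x then (1 : ℝ) else 0) * (linKerAt (toSite r) L μ y f * G x) :=
    summable_of_ne_finset_zero (s := {(L : ℤ) • y + toSite r}) fun x hx => by
      rw [Finset.mem_singleton] at hx; rw [if_neg (fun h => hx h.symm), zero_mul]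
  have hsQ : Summable fun x : Site (d + 1) => (if f.2 = x then (1 : ℝ) else 0) * (linKerAt (toSite r) L μ y f * G x) :=
    summable_of_ne_finset_zero (s := {f.2}) fun x hx => by
      rw [Finset.mem_singleton] at hx; rw [if_neg (fun h => hx h.symm), zero_mul]
  -- (2) assemble: Σ_κ (S₁ − S₂) = Σ' x, G x · Σ_κ (𝓋 (κ, x − e_κ) − 𝓋 (κ, x)) = Σ' x, G x · jump · q¹
  calc ∑ κ : Fin (d + 1), ∑ e ∈ offs L, vhKerAt (toSite r) L μ y f (κ, (L : ℤ) • y + e) * (G ((L : ℤ) • y + e + unitVec κ) - G ((L : ℤ) • y + e))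
      = ∑ κ : Fin (d + 1), ∑' x : Site (d + 1), (vhKerAt (toSite r) L μ y f (κ, x - unitVec κ) - vhKerAt (toSite r) L μ y f (κ, x)) * G x :=
        Finset.sum_congr rfl fun κ _ => key κ
    _ = ∑' x : Site (d + 1), ∑ κ : Fin (d + 1), (vhKerAt (toSite r) L μ y f (κ, x - unitVec κ) - vhKerAt (toSite r) L μ y f (κ, x)) * G x :=
        (Summable.tsum_finsetSum fun κ _ => hs3 κ).symm
    _ = ∑' x : Site (d + 1), ((if (L : ℤ) • y + toSite r = x then (1 : ℝ) else 0) - (if f.2 = x then (1 : ℝ) else 0)) *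
          linKerAt (toSite r) L μ y f * G x := by
        refine tsum_congr fun x => ?_
        rw [← Finset.sum_mul, vhKerAt_div_right hL (toSite r) μ y f x]
    _ = (∑' x : Site (d + 1), (if (L : ℤ) • y + toSite r = x then (1 : ℝ) else 0) * (linKerAt (toSite r) L μ y f * G x)) -
          ∑' x : Site (d + 1), (if f.2 = x then (1 : ℝ) else 0) * (linKerAt (toSite r) L μ y f * G x) := by
        rw [← hsP.tsum_sub hsQ]
        exact tsum_congr fun x => by ring
    _ = (G ((L : ℤ) • y + toSite r) - G f.2) * linKerAt (toSite r) L μ y f := by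
        rw [tsum_eq_single ((L : ℤ) • y + toSite r) (fun x hx => by rw [if_neg (fun h => hx h.symm), zero_mul]),
          tsum_eq_single f.2 (fun x hx => by rw [if_neg (fun h => hx h.symm), zero_mul]), if_pos rfl, if_pos rfl]
        ring

/-- [folklore] **THE COMPOSITE ROOTED LINEAR KERNEL ON PURE GAUGES** (an1's bricks `linKerAt (toSite (r k)) L`, in-block roots, `1 ≤ L`): the fine pure gauge is mapped to the
coarse pure gauge read at the COMPOSED ROOT `R m = Σ_{k<m} L^k • ρ_k`. -/
theorem compLinKer_div_rooted (hL : 1 ≤ L) {r : ℕ → Fin (d + 1) → ℕ} (hr : ∀ k, r k ∈ box (d + 1) L) (m : ℕ) (g : Bond (d + 1)) (w : Site (d + 1)) :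
    ∑ κ : Fin (d + 1), (compLinKer (fun k => linKerAt (toSite (r k)) L) L m (κ, w - unitVec κ) g -
        compLinKer (fun k => linKerAt (toSite (r k)) L) L m (κ, w) g) =
      (if ((L ^ m : ℕ) : ℤ) • (g.2 + unitVec g.1) + ∑ k ∈ Finset.range m, ((L ^ k : ℕ) : ℤ) • toSite (r k) = w then (1 : ℝ) else 0) -
        (if ((L ^ m : ℕ) : ℤ) • g.2 + ∑ k ∈ Finset.range m, ((L ^ k : ℕ) : ℤ) • toSite (r k) = w then (1 : ℝ) else 0) :=
  compLinKer_div (ρ := fun k => toSite (r k)) (R := fun m => ∑ k ∈ Finset.range m, ((L ^ k : ℕ) : ℤ) • toSite (r k))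
    (by simp) (fun m => by rw [Finset.sum_range_succ]) (fun k μ y G => linKerAt_window_dz hL (hr k) μ y G) m g w

/-- [folklore] **THE COMPOSITE ROOTED FIRST-ORDER WARD LAW, KERNEL LEVEL** (an1's bricks `linKerAt ∕ vhKerAt (toSite (r k)) L`, in-block roots, `1 ≤ L`; every depth `m`):
`Σ_κ (compVHKer m μ y f (κ, z − e_κ) − compVHKer m μ y f (κ, z)) = ([L^m•y + R m = z] − [f.2 = z]) · compLinKer m f (μ, y)`, `R m = Σ_{k<m} L^k • toSite (r k)`. -/
theorem compVHKer_div_right_rooted (hL : 1 ≤ L) {r : ℕ → Fin (d + 1) → ℕ} (hr : ∀ k, r k ∈ box (d + 1) L) (m : ℕ) (μ : Fin (d + 1)) (y : Site (d + 1))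
    (f : Bond (d + 1)) (z : Site (d + 1)) :
    ∑ κ : Fin (d + 1), (compVHKer (fun k => linKerAt (toSite (r k)) L) (fun k => vhKerAt (toSite (r k)) L) L m μ y f (κ, z - unitVec κ) -
        compVHKer (fun k => linKerAt (toSite (r k)) L) (fun k => vhKerAt (toSite (r k)) L) L m μ y f (κ, z)) =
      ((if ((L ^ m : ℕ) : ℤ) • y + ∑ k ∈ Finset.range m, ((L ^ k : ℕ) : ℤ) • toSite (r k) = z then (1 : ℝ) else 0) - (if f.2 = z then (1 : ℝ) else 0)) *
        compLinKer (fun k => linKerAt (toSite (r k)) L) L m f (μ, y) :=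
  compVHKer_div_right (ρ := fun k => toSite (r k)) (R := fun m => ∑ k ∈ Finset.range m, ((L ^ k : ℕ) : ℤ) • toSite (r k))
    (by simp) (fun m => by rw [Finset.sum_range_succ]) (fun k μ y G => linKerAt_window_dz hL (hr k) μ y G)
    (fun k μ y f G => vhKerAt_window_dz hL (hr k) μ y f G) m μ y f z

end Rooted

end Summit.QuantumFields.BalabanUV.Beta.CompositeVertexWardRooted

end
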